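import Summits.CriticalPhenomena.CardyFormulaZ2.Theses.DyadicBetaRigidity
import Summits.CriticalPhenomena.CardyFormulaZ2.Theorems.CardyBoundaryCoulombGasAssemblySandwich
import Summits.CriticalPhenomena.CardyFormulaZ2.Theorems.DyadicBetaRigidityDyadicBetaSufficesBeta
import Summits.CriticalPhenomena.CardyFormulaZ2.Theorems.DyadicBetaRigidityDyadicBetaSufficesContinuity
import Summits.CriticalPhenomena.CardyFormulaZ2.Theorems.DyadicBetaRigidityDyadicBetaSufficesApprox
import Summits.CriticalPhenomena.CardyFormulaZ2.Theorems.DyadicBetaRigidityDyadicBetaSufficesDilation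
import Literature.Probability.RandomPlanarGeometry.ConformalRectangleProofs

/-!
# `DyadicBetaSuffices`: the dyadic lattice-polygon law along `h/2^k` gives the crossing limit of
# every conformal rectangle along all meshes (route DyadicBetaRigidity of `CardyFormulaZ2`)

Item stmt-CriticalPhenomena-18184 (support, the glue of the decomposition
`CardyFormulaZ2 ⇐ DyadicLatticeBetaLaw ∧ CardyRigidity`). For a law `F` continuous on `(0, 1)` with
`F(1 - η) = 1 - F(η)`: if for every mesh `h > 0` and every conformal rectangle `P` whose frontier is
covered by finitely many edges of `hℤ²` the `P_{1/2}` bond-`ℤ²` crossing probabilities converge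
ALONG THE DYADIC REFINEMENTS `h/2^k` to `F(η_P)`, then EVERY conformal rectangle `R` has crossing
limit `F(η_R)` as the mesh `δ → 0⁺` through all reals (`hasCrossingLimit_of_dyadicLattice`); with
`F = I_a` this is `DyadicBetaSuffices` (`DyadicBetaSuffices_proof`).

Proof. Bollobás–Riordan's sandwich for the G02 discretisation of bond-`ℤ²`, exactly as in
`RectilinearApproximation.cardyFormulaZ2_of_rectilinearCardy` (stubs A/B/D2 of line
`oracle-sandwich`, `discreteCrossing_subset_of_lower`, `discreteCrossing_subset_plate`,
`bond_le_one_sub_real_openCrossing`), with ONE new ingredient, MESH ARITHMETIC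
(`eventually_lt_of_dilates`): the lattice-polygon approximant `P` (mesh `d`, marks of the
comparison quad, `exists_latticePolygon_close_marks`) is a `(d/N)`-lattice polygon for every
`N ≥ 1` (`latticePolygon_refine`), so the hypothesis gives its crossing limit along the finitely
many sequences `d/(N 2^k)`, `2^m₀ ≤ N < 2^(m₀+1)`; every small mesh is `δ = c · d/(N 2^k)` with
`c ∈ (1 - 2^{-m₀}, 1]` (`exists_mesh_decomposition`), and by the EXACT DILATION COVARIANCE of the
discretisation (`bondDomainCrossingProb_dilate`) `P[cP, δ] = P[P, d/(N 2^k)]`, while the dilate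
`cP` (same marks, loop moved by `≤ (1 - c) · sup |∂P|`) is still in sandwich position, so stub A
(resp. stub B + self-duality, for the cyclically re-marked copy, using `F(1-η) = 1 - F(η)`) compares
`P[cP, δ]` with `P[R, δ]`.

References: B. Bollobás, O. Riordan, *Percolation* (2006), Ch. 7 Lemma 14, Claims 19–20, remark
p. 195; S. Smirnov, C. R. Acad. Sci. Paris 333 (2001), §2; O. Schramm, S. Smirnov, *On the scaling
limits of planar percolation*, Ann. Probab. 39 (2011), §1.
-/

noncomputable section

open scoped Pointwise

namespace Summit.CriticalPhenomena.CardyFormulaZ2.Theorems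

namespace DyadicLattice

open Set Metric Filter Topology MeasureTheory
open Literature.Probability.LatticeModels Literature.Probability.Percolation
open Literature.Probability.RandomPlanarGeometry
open Summit.CriticalPhenomena.CardyFormulaZ2.Cruxes.LoopsToCrossings.OracleSandwich
  (stub_discreteCrossing_of_pathIn stub_not_discreteCrossing_of_dualPathIn stub_comparisonGeometry)
open RectilinearApproximation
  (discreteCrossing_subset_of_lower discreteCrossing_subset_plate bond_le_one_sub_real_openCrossing)

/-! ### Mesh arithmetic: dyadic limits of one lattice polygon bound a comparison family at all meshes -/

/-- **The dyadic limits of one lattice polygon control all small meshes.** Let `P` be a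
conformal rectangle whose frontier is covered by edges of `dℤ²`, with uniformizing datum `(ψ, y)`,
and suppose the dyadic-refinement hypothesis `hD` (crossing limits `F(η)` along `h/2^k` for every
lattice polygon at every mesh `h`). If a quantity `g δ` dominates the crossing probability at mesh
`δ` of EVERY dilate `cP`, `c ∈ (0, 1]`, whose loop is pointwise `ρ`-close to that of `P`
(`0 < δ < δ₂`), then `F(η_P) - e < g δ` for all small `δ`: `P` is a `(d/N)`-lattice polygon for
the finitely many `N ∈ [2^m₀, 2^(m₀+1))`, every small `δ` is `c · d/(N 2^k)` with `c ≈ 1`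
(`exists_mesh_decomposition`), and `P[cP, δ] = P[P, d/(N 2^k)]` (`bondDomainCrossingProb_dilate`).
[cite: BollobasRiordan2006, Ch. 7 remark p. 195] -/
theorem eventually_lt_of_dilates {F : ℝ → ℝ}
    (hD : ∀ h : ℝ, 0 < h → ∀ R : ConformalRectangle, (∃ S : Finset (ℂ × ℂ),
        (∀ p ∈ S, ∃ u v : Site 2, (zdGraph 2).Adj u v ∧ p.1 = meshPoint h u ∧ p.2 = meshPoint h v) ∧
        frontier R.carrier ⊆ ⋃ p ∈ S, segment ℝ p.1 p.2) →
      ∀ (φ : ConformalEquiv UpperHalfPlane.upperHalfPlaneSet R.carrier) (x : Fin 4 → ℝ),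
        R.IsUniformizing φ x →
        Tendsto (fun k : ℕ ↦ bondDomainCrossingProb R (h / 2 ^ k)) atTop (𝓝 (F (crossRatio x))))
    (P : ConformalRectangle) {d : ℝ} (hd : 0 < d)
    (hPS : ∃ S : Finset (ℂ × ℂ),
        (∀ p ∈ S, ∃ u v : Site 2, (zdGraph 2).Adj u v ∧ p.1 = meshPoint d u ∧ p.2 = meshPoint d v) ∧
        frontier P.carrier ⊆ ⋃ p ∈ S, segment ℝ p.1 p.2)
    {ψ : ConformalEquiv UpperHalfPlane.upperHalfPlaneSet P.carrier} {y : Fin 4 → ℝ}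
    (hψ : P.IsUniformizing ψ y) (g : ℝ → ℝ) {ρ δ₂ : ℝ} (hρ : 0 < ρ) (hδ₂ : 0 < δ₂)
    (hcmp : ∀ (c : ℝ) (hc : 0 < c), c ≤ 1 →
      (∀ u, dist ((c : ℂ) * P.boundary u) (P.boundary u) ≤ ρ) → ∀ δ : ℝ, 0 < δ → δ < δ₂ →
        bondDomainCrossingProb (P.imageUnivalent (fun z ↦ (c : ℂ) * z)
          (differentiableOn_mul_left _ _) (injOn_mul_left (Complex.ofReal_ne_zero.2 hc.ne') _)) δ ≤
          g δ)
    {e : ℝ} (he : 0 < e) :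
    ∀ᶠ δ : ℝ in 𝓝[>] 0, F (crossRatio y) - e < g δ := by
  -- the size of `∂P` and the dilation window `θ`
  obtain ⟨M, hM⟩ : ∃ M : ℝ, ∀ u, ‖P.boundary u‖ ≤ M := by
    obtain ⟨M, hM⟩ := P.isBounded.closure.exists_norm_le
    exact ⟨M, fun u ↦ hM _ (frontier_subset_closure (P.boundary_mem_frontier u))⟩
  set θ : ℝ := ρ / (max M 0 + 1) with hθ
  have hθ0 : 0 < θ := by rw [hθ]; positivity
  have hθM : θ * max M 0 ≤ ρ := by
    have h1 : θ * (max M 0 + 1) = ρ := by rw [hθ]; field_simp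
    nlinarith [le_max_right M 0]
  have hdil : ∀ c : ℝ, 1 - θ < c → c ≤ 1 → ∀ u, dist ((c : ℂ) * P.boundary u) (P.boundary u) ≤ ρ := by
    intro c hc1 hc2 u
    rw [dist_eq_norm, show (c : ℂ) * P.boundary u - P.boundary u = ((c - 1 : ℝ) : ℂ) * P.boundary u by
      push_cast; ring, norm_mul, Complex.norm_real, Real.norm_eq_abs, abs_of_nonpos (by linarith)]
    calc -(c - 1) * ‖P.boundary u‖ ≤ θ * max M 0 :=
          mul_le_mul (by linarith) ((hM u).trans (le_max_left _ _)) (norm_nonneg _) hθ0.le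
      _ ≤ ρ := hθM
  -- the dyadic window `[2^m₀, 2^(m₀+1))` with `2^m₀ > 1/θ`
  obtain ⟨m₀, hm₀⟩ := pow_unbounded_of_one_lt (1 / θ) (one_lt_two (α := ℝ))
  set W : Finset ℕ := Finset.Ico (2 ^ m₀) (2 ^ (m₀ + 1)) with hW
  -- the dyadic limits of `P` along `d/(N 2^k)`, uniformly in `N ∈ W`
  have hlimN : ∀ N ∈ W, Tendsto (fun k : ℕ ↦ bondDomainCrossingProb P (d / N / 2 ^ k)) atTop
      (𝓝 (F (crossRatio y))) := by
    intro N hN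
    have hN0 : 0 < N := lt_of_lt_of_le (Nat.two_pow_pos _) (Finset.mem_Ico.1 hN).1
    exact hD (d / N) (by positivity) P (latticePolygon_refine P hN0 hPS) ψ y hψ
  have hev : ∀ᶠ k : ℕ in atTop, ∀ N ∈ W,
      F (crossRatio y) - e < bondDomainCrossingProb P (d / N / 2 ^ k) :=
    (Finset.eventually_all W).2 fun N hN ↦ (hlimN N hN).eventually (lt_mem_nhds (by linarith))
  obtain ⟨K, hK⟩ := eventually_atTop.1 hev
  -- all meshes below `d / 2^(m₀+K+1)` are covered
  have hsmall : (0 : ℝ) < d / 2 ^ (m₀ + K + 1) := by positivity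
  filter_upwards [Ioo_mem_nhdsGT (lt_min hδ₂ hsmall)] with δ hδ
  obtain ⟨N, hN1, hN2, n, hKn, c, hc1, hc2, hδeq⟩ :=
    exists_mesh_decomposition hd m₀ K hδ.1 (hδ.2.le.trans (min_le_right _ _))
  have hNW : N ∈ W := Finset.mem_Ico.2 ⟨hN1, hN2⟩
  have hNr : (2 : ℝ) ^ m₀ ≤ N := by exact_mod_cast hN1
  have hN0 : (0 : ℝ) < N := lt_of_lt_of_le (by positivity) hNr
  have hc0 : 0 < c := lt_of_le_of_lt (by positivity) hc1
  -- `c > N/(N+1) ≥ 1 - θ`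
  have hcθ : 1 - θ < c := by
    refine lt_of_le_of_lt ?_ hc1
    rw [le_div_iff₀ (by positivity)]
    have h1 : 1 / θ < N := hm₀.trans_le hNr
    rw [div_lt_iff₀ hθ0] at h1
    nlinarith
  -- the comparison at mesh `δ` for the dilate `cP`, and exact covariance
  have h1 := hcmp c hc0 hc2 (hdil c hcθ hc2) δ hδ.1 (hδ.2.trans_le (min_le_left _ _))
  have h2 := bondDomainCrossingProb_dilate P hc0 (hd := differentiableOn_mul_left _ _)
    (hi := injOn_mul_left (Complex.ofReal_ne_zero.2 hc0.ne') _) (d / N / 2 ^ n)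
  rw [← hδeq] at h2
  rw [h2] at h1
  exact (hK n hKn N hNW).trans_le h1

/-! ### The sandwich -/

/-- **Dyadic lattice-polygon crossing limits along `h/2^k` give the crossing limit of every
conformal rectangle along all meshes**, for any law `F` continuous on `(0, 1)` with
`F(1 - η) = 1 - F(η)`. Bollobás–Riordan's sandwich (Ch. 7 Claim 19 + remark p. 195) for the G02
discretisation of bond-`ℤ²`: lower bound by the inclusion of crossing events for a
lattice-polygon approximant of the lower comparison quad and its near-trivial dilates (stub A,
`discreteCrossing_subset_of_lower`) plus mesh arithmetic (`eventually_lt_of_dilates`); upper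
bound by bond self-duality (stub B, `bond_le_one_sub_real_openCrossing`,
`discreteCrossing_subset_plate`) for an approximant of the upper quad of the cyclically re-marked
copy (`exists_cyclicFlip_crossRatio`, modulus `1 - η`). [cite: BollobasRiordan2006, Ch. 7 Lemma 14 p. 184, Claims 19–20 p. 192, remark p. 195] -/
theorem hasCrossingLimit_of_dyadicLattice {F : ℝ → ℝ} (hF : ContinuousOn F (Ioo 0 1))
    (hsymm : ∀ η ∈ Ioo (0 : ℝ) 1, F (1 - η) = 1 - F η)
    (hD : ∀ h : ℝ, 0 < h → ∀ R : ConformalRectangle, (∃ S : Finset (ℂ × ℂ),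
        (∀ p ∈ S, ∃ u v : Site 2, (zdGraph 2).Adj u v ∧ p.1 = meshPoint h u ∧ p.2 = meshPoint h v) ∧
        frontier R.carrier ⊆ ⋃ p ∈ S, segment ℝ p.1 p.2) →
      ∀ (φ : ConformalEquiv UpperHalfPlane.upperHalfPlaneSet R.carrier) (x : Fin 4 → ℝ),
        R.IsUniformizing φ x →
        Tendsto (fun k : ℕ ↦ bondDomainCrossingProb R (h / 2 ^ k)) atTop (𝓝 (F (crossRatio x))))
    (R : ConformalRectangle) : R.HasCrossingLimit (bondDomainCrossingProb R) F := by
  intro φ x hφ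
  set L : ℝ := F (crossRatio x) with hL
  have hη : crossRatio x ∈ Ioo (0 : ℝ) 1 := ConformalRectangle.crossRatio_mem_Ioo_of_isUniformizing hφ
  -- lower bound
  have hlow : ∀ e : ℝ, 0 < e → ∀ᶠ δ : ℝ in 𝓝[>] 0, L - e < bondDomainCrossingProb R δ := by
    intro e he
    obtain ⟨ε₁, hε₁, h1⟩ := lawContinuity hF R φ x hφ (τ := e / 2) (by positivity)
    obtain ⟨m, hm, hgeo⟩ := stub_comparisonGeometry R (ε₁ / 2) (by positivity)
    obtain ⟨δ₀, hδ₀, t₀, ht₀, hAfor⟩ := stub_discreteCrossing_of_pathIn R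
    obtain ⟨⟨Q, r, hr, hQb, hQm, hL1, hL2, hL3, hL4⟩, -⟩ := hgeo t₀ ht₀
    set ρ : ℝ := min (ε₁ / 4) (r / 4) with hρ
    have hρ0 : 0 < ρ := by rw [hρ]; positivity
    have hρε : ρ ≤ ε₁ / 4 := min_le_left _ _
    have hρr : ρ ≤ r / 4 := min_le_right _ _
    obtain ⟨P, d, hd, hPmark, hPS, hPclose⟩ := exists_latticePolygon_close_marks Q hρ0
    obtain ⟨ψ, y, hψ⟩ := MarkedDomain.exists_isUniformizing_holds P
    have hFP : |F (crossRatio y) - L| ≤ e / 2 := by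
      refine h1 P (fun u ↦ ?_) (fun i ↦ ?_) ψ y hψ
      · calc dist (P.boundary u) (R.boundary u)
            ≤ dist (P.boundary u) (Q.boundary u) + dist (Q.boundary u) (R.boundary u) :=
              dist_triangle _ _ _
          _ ≤ ρ + ε₁ / 2 := add_le_add (hPclose u) (hQb u)
          _ ≤ ε₁ := by linarith
      · rw [hPmark i]; exact (hQm i).trans (by linarith)
    have hev := eventually_lt_of_dilates hD P hd hPS hψ (bondDomainCrossingProb R) hρ0
      (lt_min hδ₀ (lt_min hm (half_pos hr))) (e := e / 2) (fun c hc _ hcl δ hδ hδ₂ ↦ by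
        have hclose : ∀ u, dist ((P.imageUnivalent (fun z ↦ (c : ℂ) * z)
            (differentiableOn_mul_left _ _) (injOn_mul_left (Complex.ofReal_ne_zero.2 hc.ne') _)).boundary u)
            (Q.boundary u) ≤ 2 * ρ := fun u ↦ by
          rw [boundary_dilate]
          linarith [dist_triangle ((c : ℂ) * P.boundary u) (P.boundary u) (Q.boundary u), hcl u, hPclose u]
        have hδ₀' : δ < δ₀ := hδ₂.trans_le (min_le_left _ _)
        have hδm : δ < m := hδ₂.trans_le ((min_le_right _ _).trans (min_le_left _ _))
        have hδr : δ < r / 2 := hδ₂.trans_le ((min_le_right _ _).trans (min_le_right _ _))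
        have hincl := discreteCrossing_subset_of_lower R Q _ hAfor hL1 hL2 hL3 hL4 hclose
          (fun i ↦ (mark_dilate P (c : ℂ) i).trans (hPmark i)) (by positivity) (by linarith) hδ hδ₀'
          hδm hδr.le ht₀.le
        rw [bondDomainCrossingProb_eq_measureReal, bondDomainCrossingProb_eq_measureReal]
        exact measureReal_mono hincl) (half_pos he)
    filter_upwards [hev] with δ hδ
    have hF' := (abs_sub_le_iff.1 hFP).2
    linarith
  -- upper bound
  have hup : ∀ e : ℝ, 0 < e → ∀ᶠ δ : ℝ in 𝓝[>] 0, bondDomainCrossingProb R δ < L + e := by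
    intro e he
    obtain ⟨R₂, _hcar, hbd, hmk, hflip⟩ := exists_cyclicFlip_crossRatio R
    obtain ⟨φ₂, x₂, hφ₂⟩ := MarkedDomain.exists_isUniformizing_holds R₂
    have hL₂ : F (crossRatio x₂) = 1 - L := by
      rw [hflip φ x φ₂ x₂ hφ hφ₂]
      exact hsymm _ hη
    obtain ⟨ε₂, hε₂, h2⟩ := lawContinuity hF R₂ φ₂ x₂ hφ₂ (τ := e / 2) (by positivity)
    obtain ⟨m, hm, hgeo⟩ := stub_comparisonGeometry R (ε₂ / 2) (by positivity)
    obtain ⟨δ₀, hδ₀, t₀, ht₀, hBfor⟩ := stub_not_discreteCrossing_of_dualPathIn R m hm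
    obtain ⟨-, ⟨N, r, hr, hNb, hNm, hU1, hU2, hU3, hU4, hU5⟩⟩ := hgeo t₀ ht₀
    set ρ : ℝ := min (ε₂ / 4) (r / 8) with hρ
    have hρ0 : 0 < ρ := by rw [hρ]; positivity
    have hρε : ρ ≤ ε₂ / 4 := min_le_left _ _
    have hρr : ρ ≤ r / 8 := min_le_right _ _
    obtain ⟨P, d, hd, hPmark, hPS, hPclose⟩ := exists_latticePolygon_close_marks N hρ0
    obtain ⟨ψ, y, hψ⟩ := MarkedDomain.exists_isUniformizing_holds P
    have hFP : |F (crossRatio y) - (1 - L)| ≤ e / 2 := by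
      rw [← hL₂]
      refine h2 P (fun u ↦ ?_) (fun i ↦ ?_) ψ y hψ
      · rw [hbd u]
        calc dist (P.boundary u) (R.boundary (u + R.mark 1))
            ≤ dist (P.boundary u) (N.boundary u) + dist (N.boundary u) (R.boundary (u + R.mark 1)) :=
              dist_triangle _ _ _
          _ ≤ ρ + ε₂ / 2 := add_le_add (hPclose u) (hNb u)
          _ ≤ ε₂ := by linarith
      · rw [hPmark i, hmk i]; exact (hNm i).trans (by linarith)
    have hev := eventually_lt_of_dilates hD P hd hPS hψ (fun δ ↦ 1 - bondDomainCrossingProb R δ) hρ0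
      (lt_min hδ₀ (lt_min (by positivity : (0 : ℝ) < m / 3) (by positivity : (0 : ℝ) < r / 4)))
      (e := e / 2) (fun c hc _ hcl δ hδ hδ₂ ↦ by
        have hclose : ∀ u, dist ((P.imageUnivalent (fun z ↦ (c : ℂ) * z)
            (differentiableOn_mul_left _ _) (injOn_mul_left (Complex.ofReal_ne_zero.2 hc.ne') _)).boundary u)
            (N.boundary u) ≤ 2 * ρ := fun u ↦ by
          rw [boundary_dilate]
          linarith [dist_triangle ((c : ℂ) * P.boundary u) (P.boundary u) (N.boundary u), hcl u, hPclose u]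
        have hδ₀' : δ < δ₀ := hδ₂.trans_le (min_le_left _ _)
        have hδm : δ < m / 3 := hδ₂.trans_le ((min_le_right _ _).trans (min_le_left _ _))
        have hδr : δ < r / 4 := hδ₂.trans_le ((min_le_right _ _).trans (min_le_right _ _))
        have hle := bond_le_one_sub_real_openCrossing R hBfor hU1 hU2 hU3 hU4 hU5 hδ hδ₀'
          (by linarith) (by linarith) ht₀.le le_rfl
        have hincl := discreteCrossing_subset_plate N _ hclose
          (fun i ↦ (mark_dilate P (c : ℂ) i).trans (hPmark i)) (by positivity) (by linarith) hδ hδr.le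
        have hle' : bondDomainCrossingProb (P.imageUnivalent (fun z ↦ (c : ℂ) * z)
            (differentiableOn_mul_left _ _) (injOn_mul_left (Complex.ofReal_ne_zero.2 hc.ne') _)) δ ≤
            (bondPercolation (zdGraph 2) half).real
              (openCrossing {x : Site 2 | meshPoint δ x ∈ cthickening (r / 2) N.carrier}
                {x | meshPoint δ x ∈ cthickening (r / 2) (N.arc 0)}
                {x | meshPoint δ x ∈ cthickening (r / 2) (N.arc 2)}) := by
          rw [bondDomainCrossingProb_eq_measureReal]
          exact measureReal_mono hincl
        show _ ≤ 1 - bondDomainCrossingProb R δ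
        linarith) (half_pos he)
    filter_upwards [hev] with δ hδ
    have hF' := (abs_sub_le_iff.1 hFP).2
    linarith
  rw [Metric.tendsto_nhds]
  intro e he
  filter_upwards [hlow e he, hup e he] with δ hδ1 hδ2
  rw [Real.dist_eq, abs_sub_lt_iff]
  constructor <;> linarith

/-- **The glue of route DyadicBetaRigidity** for the beta laws: for `a ∈ (0, 1)`, if the bond-`ℤ²`
crossing probabilities of every lattice polygon of every mesh `h` converge along `h/2^k` to
`I_a(η) = ∫₀^η (s(1-s))^{-a} / ∫₀¹ (s(1-s))^{-a}`, then every conformal rectangle has crossing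
limit `I_a(η)` along all meshes (`hasCrossingLimit_of_dyadicLattice` with the continuity and the
symmetry `I_a(1-η) = 1 - I_a(η)` of the beta law). [cite: BollobasRiordan2006, Ch. 7 remark p. 195] -/
theorem hasCrossingLimit_betaLaw_of_dyadicLattice {a : ℝ} (ha : a ∈ Ioo (0 : ℝ) 1)
    (hD : ∀ h : ℝ, 0 < h → ∀ R : ConformalRectangle, (∃ S : Finset (ℂ × ℂ),
        (∀ p ∈ S, ∃ u v : Site 2, (zdGraph 2).Adj u v ∧ p.1 = meshPoint h u ∧ p.2 = meshPoint h v) ∧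
        frontier R.carrier ⊆ ⋃ p ∈ S, segment ℝ p.1 p.2) →
      ∀ (φ : ConformalEquiv UpperHalfPlane.upperHalfPlaneSet R.carrier) (x : Fin 4 → ℝ),
        R.IsUniformizing φ x →
        Tendsto (fun k : ℕ ↦ bondDomainCrossingProb R (h / 2 ^ k)) atTop
          (𝓝 ((∫ s in (0 : ℝ)..crossRatio x, (s * (1 - s)) ^ (-a)) /
            ∫ s in (0 : ℝ)..1, (s * (1 - s)) ^ (-a))))
    (R : ConformalRectangle) :
    R.HasCrossingLimit (bondDomainCrossingProb R)
      (fun η : ℝ ↦ (∫ s in (0 : ℝ)..η, (s * (1 - s)) ^ (-a)) / ∫ s in (0 : ℝ)..1, (s * (1 - s)) ^ (-a)) :=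
  hasCrossingLimit_of_dyadicLattice (continuousOn_betaLaw ha.2)
    (fun _ hη ↦ betaLaw_one_sub ha.2 ⟨hη.1.le, hη.2.le⟩) hD R

end DyadicLattice

/-- **`DyadicBetaSuffices`** (support item stmt-CriticalPhenomena-18184 of route DyadicBetaRigidity):
for every `a ∈ (0, 1)`, the dyadic lattice-polygon beta law for `I_a` implies that every conformal
rectangle has bond-`ℤ²` crossing limit `I_a(η)` as `δ → 0⁺` through all reals. [cite: BollobasRiordan2006, Ch. 7 remark p. 195] -/
theorem DyadicBetaSuffices_proof :
    Summit.CriticalPhenomena.CardyFormulaZ2.Theses.DyadicBetaRigidity.DyadicBetaSuffices := by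
  intro a ha hD R
  exact DyadicLattice.hasCrossingLimit_betaLaw_of_dyadicLattice ha hD R

end Summit.CriticalPhenomena.CardyFormulaZ2.Theorems
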